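import Mathlib
import HarnessLib
import Summits.NavierStokesRegularity.NavierStokesRegularity.Theorems.UnthreadedRigidityDoorUnthreadedRigidityVirialHornTwoChannelSource

/-!
# Route `UnthreadedRigidityDoor`, item `UnthreadedRigidity` (W2, stmt-NavierStokesRegularity-27585) — LINE g11-1 «VIRIAL HORN»,
# BRIDGE V for PLATEAU PROFILES («TWO-CHANNEL RIGIDITY»), file 3: THE RADIAL LAYER UNDER THE WEAK DECAY OF `VirialAdmissible`

Prover file (W2 Lean hand ns-crc-p1 g10, by lineage; `--supports stmt-NavierStokesRegularity-27585 --as helper`; objects BY NAME in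
`Theorems/UnthreadedRigidityDoorUnthreadedRigidityVirialHornTwoChannelDefs.lean`, p726708 / p728780 and its second append).

Content: g9's decaying radial coefficient `HornPressure.radCoeff L g` for channels with ANY integrable power decay `|g| ≤ K/σ^{m+2}`
(`contDiff_radCoeff_of_decay`, `deriv_radCoeff_of_decay`, the radial ODE `radCoeff_ode_of_decay` on `[0,∞)`), and ★ the WEAK-DECAY BOUND
`abs_radCoeff_sq_le_weak` / `abs_radCoeff_le_weak`: for `2 ≤ q ≤ L+1`, `|g| ≤ K/σ^q` gives `|radCoeff L g σ| ≤ C/σ^{q−1}` — the regime of a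
degree-`l ≥ 3` shell, where the inner moment need not converge (g9's strong bound needs `q ≥ L+2`).
HONEST LABEL: slice-level calculus / real analysis about SPECIAL (separable) data; a piece of the L-part of ONE bridge of a RUNG line on the
wall item; `UnthreadedRigidity` (27585), W2 and NS regularity remain OPEN; nothing here is a statement about Navier–Stokes regularity.  0 kit.
-/

-- the summit and its single sub-problem share the name (CONVENTIONS §1), as in every Theorems file
set_option linter.dupNamespace false

namespace Summit.NavierStokesRegularity.NavierStokesRegularity.Theorems.UnthreadedRigidity.VirialHorn

open scoped RealInnerProductSpace Topology Laplacian
open Filter Set MvPolynomial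
open Literature.Combinatorics.LorentzianPolynomials (pderiv_pderiv_comm)
open Summit.NavierStokesRegularity.NavierStokesRegularity.Theorems.UnthreadedRigidity.ProfileHorn (E3)
open Summit.NavierStokesRegularity.NavierStokesRegularity.Theorems.UnthreadedRigidity.HornPressure (radCoeff)
open Summit.NavierStokesRegularity.NavierStokesRegularity.Theorems.PoloidalLiouville.HorizonTower hiding E3

/-! ## §4 The radial layer under weak decay (g9's `HornPressure.radCoeff`, any decay exponent) -/

section Radial

open scoped ContDiff
open MeasureTheory
open Summit.NavierStokesRegularity.NavierStokesRegularity.Theorems.UnthreadedRigidity.HornPressure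
  (Gin Gout contDiff_Gin Gin_zero integral_pow_mul_eq_Gin two_mul_deriv_Gin decayConst_nonneg hasDerivAt_Gout contDiff_Gout
    abs_Gout_le abs_radCoeff_sq_le)

variable {g : ℝ → ℝ} {K : ℝ} {m : ℕ}

/-- `radCoeff L g` is smooth for a smooth channel with ANY integrable power decay `|g| ≤ K/σ^{m+2}`. -/
theorem contDiff_radCoeff_of_decay (hg : ContDiff ℝ ∞ g) (L : ℕ) (hK : ∀ σ : ℝ, 1 ≤ σ → |g σ| ≤ K / σ ^ (m + 2)) :
    ContDiff ℝ ∞ (radCoeff L g) := by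
  unfold radCoeff
  exact ((contDiff_id.mul (contDiff_Gin hg L)).add ((contDiff_Gout hg hK).div_const 2)).div_const _

/-- `radCoeff′ = −Gin/2` on `[0,∞)` (any decay exponent). -/
theorem deriv_radCoeff_of_decay (hg : ContDiff ℝ ∞ g) (L : ℕ) (hK : ∀ σ : ℝ, 1 ≤ σ → |g σ| ≤ K / σ ^ (m + 2))
    {s : ℝ} (hs : 0 ≤ s) : deriv (radCoeff L g) s = -(Gin L g s) / 2 := by
  have hGd : Differentiable ℝ (Gin L g) := (contDiff_Gin hg L).differentiable (by simp)
  have h1 : HasDerivAt (fun x => x * Gin L g x) (1 * Gin L g s + s * deriv (Gin L g) s) s :=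
    (hasDerivAt_id s).mul (hGd s).hasDerivAt
  have h2 : HasDerivAt (fun x => Gout g x / 2) (-g s / 2) s := (hasDerivAt_Gout hg.continuous hK s).div_const 2
  have h3 : HasDerivAt (radCoeff L g) ((1 * Gin L g s + s * deriv (Gin L g) s + -g s / 2) / (2 * L + 1)) s := by
    have := (h1.add h2).div_const (2 * (L : ℝ) + 1)
    exact this
  rw [h3.deriv]
  have hode := two_mul_deriv_Gin hg L hs
  have hL : (2 * (L : ℝ) + 1) ≠ 0 := by positivity
  field_simp
  linarith

/-- THE RADIAL ODE `4 s β″ + (4L+6) β′ = −g` on `[0, ∞)` (any decay exponent). -/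
theorem radCoeff_ode_of_decay (hg : ContDiff ℝ ∞ g) (L : ℕ) (hK : ∀ σ : ℝ, 1 ≤ σ → |g σ| ≤ K / σ ^ (m + 2))
    {s : ℝ} (hs : 0 ≤ s) :
    4 * s * deriv (deriv (radCoeff L g)) s + (4 * L + 6) * deriv (radCoeff L g) s = -g s := by
  rcases hs.eq_or_lt with h0 | hpos
  · subst h0
    rw [deriv_radCoeff_of_decay hg L hK le_rfl, Gin_zero]
    have hL : (2 * (L : ℝ) + 3) ≠ 0 := by positivity
    field_simp
    ring
  · have hev : deriv (radCoeff L g) =ᶠ[𝓝 s] fun x => -(Gin L g x) / 2 := by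
      filter_upwards [Ioi_mem_nhds hpos] with x hx using deriv_radCoeff_of_decay hg L hK (le_of_lt hx)
    have hGd : Differentiable ℝ (Gin L g) := (contDiff_Gin hg L).differentiable (by simp)
    have h2 : deriv (deriv (radCoeff L g)) s = -(deriv (Gin L g) s) / 2 := by
      rw [hev.deriv_eq]
      exact ((hGd s).hasDerivAt.neg.div_const 2).deriv
    rw [h2, deriv_radCoeff_of_decay hg L hK hpos.le]
    have hode := two_mul_deriv_Gin hg L hpos.le
    linarith

/-- ★ WEAK-DECAY BOUND of the multipole coefficient (the regime of `VirialAdmissible`, where the inner moment need not converge):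
if `|g σ| ≤ K/σ^q` on `[1,∞)` with `2 ≤ q ≤ L+1` then `|radCoeff L g (r²)| ≤ C / r^{2q−2}` for `r ≥ 1`. -/
theorem abs_radCoeff_sq_le_weak (hgc : Continuous g) (L q : ℕ) (hq : 2 ≤ q) (hqL : q ≤ L + 1)
    (hK : ∀ σ : ℝ, 1 ≤ σ → |g σ| ≤ K / σ ^ q) :
    ∃ C : ℝ, ∀ r : ℝ, 1 ≤ r → |radCoeff L g (r ^ 2)| ≤ C / r ^ (2 * q - 2) := by
  obtain ⟨m, rfl⟩ : ∃ m, q = m + 2 := ⟨q - 2, by omega⟩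
  have hK0 := decayConst_nonneg hK
  set C₀ := |∫ ρ in (0 : ℝ)..1, ρ ^ (2 * L + 2) * g (ρ ^ 2)| with hC₀
  refine ⟨C₀ + K + K, fun r hr => ?_⟩
  have hr0 : 0 < r := by linarith
  have hf : Continuous fun ρ : ℝ => ρ ^ (2 * L + 2) * g (ρ ^ 2) := by fun_prop
  -- the inner moment, split at `ρ = 1`
  have hsplit : ∫ ρ in (0 : ℝ)..r, ρ ^ (2 * L + 2) * g (ρ ^ 2) =
      (∫ ρ in (0 : ℝ)..1, ρ ^ (2 * L + 2) * g (ρ ^ 2)) + ∫ ρ in (1 : ℝ)..r, ρ ^ (2 * L + 2) * g (ρ ^ 2) :=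
    (intervalIntegral.integral_add_adjacent_intervals (hf.intervalIntegrable _ _) (hf.intervalIntegrable _ _)).symm
  have htail : |∫ ρ in (1 : ℝ)..r, ρ ^ (2 * L + 2) * g (ρ ^ 2)| ≤ K * r ^ (2 * L + 2 - 2 * (m + 2)) * r := by
    have hb : ∀ ρ ∈ Set.uIoc (1 : ℝ) r, ‖ρ ^ (2 * L + 2) * g (ρ ^ 2)‖ ≤ K * r ^ (2 * L + 2 - 2 * (m + 2)) := by
      intro ρ hρ
      rw [uIoc_of_le hr] at hρ
      have hρ1 : 1 ≤ ρ := hρ.1.le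
      have hρ0 : 0 < ρ := by linarith
      have hρ2 : 1 ≤ ρ ^ 2 := by nlinarith
      rw [Real.norm_eq_abs, abs_mul, abs_of_nonneg (by positivity)]
      have hsplitpow : ρ ^ (2 * L + 2) = ρ ^ (2 * L + 2 - 2 * (m + 2)) * (ρ ^ 2) ^ (m + 2) := by
        rw [← pow_mul, ← pow_add]; congr 1; omega
      calc ρ ^ (2 * L + 2) * |g (ρ ^ 2)| ≤ ρ ^ (2 * L + 2) * (K / (ρ ^ 2) ^ (m + 2)) :=
            mul_le_mul_of_nonneg_left (hK _ hρ2) (by positivity)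
        _ = K * ρ ^ (2 * L + 2 - 2 * (m + 2)) := by
            rw [hsplitpow]; field_simp
        _ ≤ K * r ^ (2 * L + 2 - 2 * (m + 2)) :=
            mul_le_mul_of_nonneg_left (pow_le_pow_left₀ hρ0.le hρ.2 _) hK0
    have := intervalIntegral.norm_integral_le_of_norm_le_const hb
    rw [Real.norm_eq_abs, abs_of_nonneg (by linarith : (0:ℝ) ≤ r - 1)] at this
    calc |∫ ρ in (1 : ℝ)..r, ρ ^ (2 * L + 2) * g (ρ ^ 2)| ≤ K * r ^ (2 * L + 2 - 2 * (m + 2)) * (r - 1) := this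
      _ ≤ K * r ^ (2 * L + 2 - 2 * (m + 2)) * r := by
          apply mul_le_mul_of_nonneg_left (by linarith) (by positivity)
  -- `r² Gin(r²) = r^{−(2L+1)} ∫₀ʳ …`
  have hGin : r ^ 2 * Gin L g (r ^ 2) = (r ^ (2 * L + 1))⁻¹ * ∫ ρ in (0 : ℝ)..r, ρ ^ (2 * L + 2) * g (ρ ^ 2) := by
    rw [integral_pow_mul_eq_Gin]
    field_simp
    ring
  have hpow1 : r ^ (2 * L + 2 - 2 * (m + 2)) * r = r ^ (2 * L + 3 - 2 * (m + 2)) := by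
    rw [← pow_succ]; congr 1; omega
  have h1 : |r ^ 2 * Gin L g (r ^ 2)| ≤ (C₀ + K) / r ^ (2 * (m + 2) - 2) := by
    rw [hGin, abs_mul, abs_inv, abs_of_pos (pow_pos hr0 _), hsplit]
    have hA : |(∫ ρ in (0 : ℝ)..1, ρ ^ (2 * L + 2) * g (ρ ^ 2)) + ∫ ρ in (1 : ℝ)..r, ρ ^ (2 * L + 2) * g (ρ ^ 2)|
        ≤ C₀ + K * r ^ (2 * L + 3 - 2 * (m + 2)) := by
      refine (abs_add_le _ _).trans (add_le_add le_rfl ?_)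
      rw [← hpow1, ← mul_assoc]; exact htail
    have hstep : (r ^ (2 * L + 1))⁻¹ * (C₀ + K * r ^ (2 * L + 3 - 2 * (m + 2))) ≤ (C₀ + K) / r ^ (2 * (m + 2) - 2) := by
      rw [inv_mul_eq_div, div_le_div_iff₀ (pow_pos hr0 _) (pow_pos hr0 _)]
      have hC₀0 : 0 ≤ C₀ := abs_nonneg _
      have e1 : C₀ * r ^ (2 * (m + 2) - 2) ≤ C₀ * r ^ (2 * L + 1) :=
        mul_le_mul_of_nonneg_left (pow_le_pow_right₀ hr (by omega)) hC₀0
      have e2 : K * r ^ (2 * L + 3 - 2 * (m + 2)) * r ^ (2 * (m + 2) - 2) = K * r ^ (2 * L + 1) := by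
        rw [mul_assoc, ← pow_add]; congr 2; omega
      nlinarith [e1, e2]
    exact (mul_le_mul_of_nonneg_left hA (by positivity)).trans hstep
  have h2 : |Gout g (r ^ 2)| ≤ K / r ^ (2 * (m + 2) - 2) := by
    have hr2 : 1 ≤ r ^ 2 := by nlinarith
    refine (abs_Gout_le hgc hK hr2).trans ?_
    rw [← pow_mul, show 2 * (m + 1) = 2 * (m + 2) - 2 by omega]
    apply div_le_div_of_nonneg_left hK0 (by positivity)
    exact le_mul_of_one_le_left (by positivity) (by norm_cast; omega)
  have hL1 : (1 : ℝ) ≤ 2 * (L : ℝ) + 1 := by norm_cast; omega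
  unfold radCoeff
  rw [abs_div, abs_of_pos (by positivity : (0:ℝ) < 2 * (L : ℝ) + 1)]
  calc |r ^ 2 * Gin L g (r ^ 2) + Gout g (r ^ 2) / 2| / (2 * (L : ℝ) + 1)
      ≤ |r ^ 2 * Gin L g (r ^ 2) + Gout g (r ^ 2) / 2| := div_le_self (abs_nonneg _) hL1
    _ ≤ |r ^ 2 * Gin L g (r ^ 2)| + |Gout g (r ^ 2) / 2| := abs_add_le _ _
    _ ≤ (C₀ + K) / r ^ (2 * (m + 2) - 2) + K / r ^ (2 * (m + 2) - 2) := by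
        refine add_le_add h1 ?_
        rw [abs_div, abs_two]
        have hpos : 0 ≤ |Gout g (r ^ 2)| := abs_nonneg _
        linarith
    _ = (C₀ + K + K) / r ^ (2 * (m + 2) - 2) := by ring

/-- the same bound in the variable `s`: `|radCoeff L g σ| ≤ C / σ^{q−1}` for `σ ≥ 1`. -/
theorem abs_radCoeff_le_weak (hgc : Continuous g) (L q : ℕ) (hq : 2 ≤ q) (hqL : q ≤ L + 1)
    (hK : ∀ σ : ℝ, 1 ≤ σ → |g σ| ≤ K / σ ^ q) :
    ∃ C : ℝ, ∀ σ : ℝ, 1 ≤ σ → |radCoeff L g σ| ≤ C / σ ^ (q - 1) := by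
  obtain ⟨C, hC⟩ := abs_radCoeff_sq_le_weak hgc L q hq hqL hK
  refine ⟨C, fun σ hσ => ?_⟩
  have hσ0 : 0 ≤ σ := by linarith
  have hr : 1 ≤ Real.sqrt σ := by rw [← Real.sqrt_one]; exact Real.sqrt_le_sqrt hσ
  have h := hC (Real.sqrt σ) hr
  rw [Real.sq_sqrt hσ0] at h
  rwa [show 2 * q - 2 = 2 * (q - 1) by omega, pow_mul, Real.sq_sqrt hσ0] at h

/-- the strong bound of g9 (`abs_radCoeff_sq_le`) in the variable `s`: `|radCoeff L g σ| ≤ C/σ^{L} · σ^{-1/2}` weakened to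
`C / σ^L`… — we only need the case `L = 0`: `|radCoeff 0 g (r²)| ≤ C / r`. -/
theorem abs_radCoeff_zero_sq_le (hg : ContDiff ℝ ∞ g) (hK : ∀ σ : ℝ, 1 ≤ σ → |g σ| ≤ K / σ ^ 2) :
    ∃ C : ℝ, ∀ r : ℝ, 1 ≤ r → |radCoeff 0 g (r ^ 2)| ≤ C / r := by
  obtain ⟨C, hC⟩ := abs_radCoeff_sq_le hg 0 (K := K) (by simpa using hK)
  exact ⟨C, fun r hr => by simpa using hC r hr⟩

end Radial

end Summit.NavierStokesRegularity.NavierStokesRegularity.Theorems.UnthreadedRigidity.VirialHorn
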